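import Summits.KontsevichZagierPeriods.KontsevichZagierPeriods.Theses.IsogenyCertificates
import Summits.KontsevichZagierPeriods.KontsevichZagierPeriods.Theorems.XMapKernel.Negative.Core
import Summits.KontsevichZagierPeriods.KontsevichZagierPeriods.Theorems.IsogenyCertificatesXMapPeriodTransfer
import Summits.KontsevichZagierPeriods.KontsevichZagierPeriods.Theorems.IsogenyCertificatesXMapKernelRealPeriodCell
import Literature.NumberTheory.Transcendental.ManyCurveThetaClassification

/-!
# Skeleton — crux `XMapKernel` (stmt-KontsevichZagierPeriods-10663), line `axiom-saturated-sector-peeling`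
(payload slug `line-axiom-saturated-sector-peeling`; lead c2's registration 1 with the stub HW CLOSED — lead prover a2,
2026-08-16)

Status (lead a2). The named fact `HuberWustholzManyCurvePeriods` is now a THEOREM of the tree
(`HuberWustholzManyCurvePeriods_holds`, `Literature/NumberTheory/Transcendental/ManyCurveThetaClassification.lean`), so
`stub_huberWustholzManyCurvePeriods` below is closed by `exact`; the cell `ellipticSectorKernel_of` is thereby
unconditional (landed as `XMapKernelCells.ellipticSectorKernel_holds`,
`Theorems/IsogenyCertificatesXMapKernelCellsUnconditional.lean`). The skeleton has EXACTLY ONE `sorry`: K =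
`stub_kernelModElliptic`, and K ↔ `KontsevichZagierPeriods` is an unconditional theorem
(`XMapKernelCells.kernelModElliptic_iff_summit_holds`; here `stub_kernelModElliptic_iff_summit HuberWustholzManyCurvePeriods_holds`).
What follows is lead c2's record of registration 1.

The line (Ideas/axiom-saturated-sector-peeling.md, SketchIdeator1.lean Card P): with the x-map period relators
ADJOINED AS GENERATORS, the kernel conjecture restricted to the elliptic real-period sector
`E = ℤ⟨[{x³+Ax+B>0}, a/√(x³+Ax+B)] : (A,B) ∈ ℤ² nonsingular, a ∈ ℚ_{>0}⟩` needs transcendence only (H1 rational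
period ratio along a datum + H2 Huber–Wüstholz splitting along datum-classes + rule (1b)): CELL
`EllipticSectorXMapKernel`. The declared remainder is `KernelModElliptic` ("every kernel element is a relation
modulo an element of E"), and `cardP_composition : cell → KernelModElliptic → XMapKernel`.

Status at registration (lead c2, 2026-08-16): the cell is ALREADY a theorem of the tree — it is a corollary, by
monotonicity of `AddSubgroup.closure`, of the landed real-period cell of the sibling line `isogeny-orbit-collapse`
(`XMapKernelRealPeriodCell.realPeriodCellKernel`, p95323: same sector with `a ∈ ℚ`, same conclusion `closure gens`,
same transcendence input), conditional on the named fact `HuberWustholzManyCurvePeriods` (HW) exactly as there;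
it is PROVED below (`ellipticSectorKernel_of`), so the line has two stubs only:
* `stub_huberWustholzManyCurvePeriods` — the named fact HW (Huber–Wüstholz 2022 Thm 15.3 = Wüstholz's analytic
  subgroup theorem; literature debt, not provable by a seat);
* `stub_kernelModElliptic` — K, the remainder. It FOLLOWS from the crux unconditionally
  (`kernelModElliptic_of_xMapKernel`: the enlarged move group is `KZ.relations` since `XMapPeriodTransfer` is
  proved) and implies the crux given the cell (`XMapKernel_of`), so given HW it is EQUIVALENT to the crux, i.e. to
  the summit `KontsevichZagierPeriods` (`stub_kernelModElliptic_iff_summit`, from Disproof F1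
  `iff_summit_of_transfer` ∘ `XMapPeriodTransfer_of`): crux-sized = summit-sized, carried openly.
Disproof.lean (cycle 2) read: no Targets; F1 is the content of `stub_kernelModElliptic_iff_summit`; F4b/F4c/F8
constrain proofs of K only.
-/

noncomputable section

-- work file under `Cruxes/…/Lines`: the prescribed namespace repeats the summit name; silence only that linter.
set_option linter.dupNamespace false

namespace Summit.KontsevichZagierPeriods.KontsevichZagierPeriods.Cruxes.XMapKernel.Lines.AxiomSaturatedSectorPeeling

open Literature.NumberTheory.Transcendental
open Summit.KontsevichZagierPeriods.KontsevichZagierPeriods.Theses.IsogenyCertificates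
open Summit.KontsevichZagierPeriods.IsogenyCertificates (XMapPeriodTransferCells.XMapPeriodTransfer_of)
open Summit.KontsevichZagierPeriods.IsogenyCertificates.XMapKernelRealPeriodCell (realPeriodCellKernel)
open Summit.KontsevichZagierPeriods.XMapKernel.Negative
open Set MeasureTheory

/-! ### Stub HW — the transcendence fact (CLOSED) -/

/-- **HW** — CLOSED (lead a2): the Huber–Wüstholz `k`-curve period theorem (Huber–Wüstholz 2022, Thm 15.3 (1)) is the
tree's `HuberWustholzManyCurvePeriods_holds` (Baker–Wüstholz analytic subgroup theorem + Philippon's zero estimate). -/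
theorem stub_huberWustholzManyCurvePeriods : Literature.NumberTheory.Transcendental.HuberWustholzManyCurvePeriods :=
  HuberWustholzManyCurvePeriods_holds

/-! ### The cell — PROVED (corollary of the landed real-period cell p95323) -/

/-- **The cell `EllipticSectorXMapKernel`** (H1 + H2 + rule (1b) of the card, all inside the landed
`realPeriodCellKernel`): conditionally on HW, every element of value `0` of the subgroup generated by the
elliptic real-period representations `[{x³+Ax+B>0}, a/√(x³+Ax+B)]`, `a ∈ ℚ_{>0}`, lies in `closure gens`. -/
theorem ellipticSectorKernel_of (hHW : Literature.NumberTheory.Transcendental.HuberWustholzManyCurvePeriods) :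
    ∀ e ∈ AddSubgroup.closure {d : KZ.FormalRep | ∃ (A B : ℤ) (a : ℚ) (r : KZ.IntegralRep 1), 4 * A ^ 3 + 27 * B ^ 2 ≠ 0 ∧ 0 < a ∧ r.domain = {x | 0 < x 0 ^ 3 + (A : ℝ) * x 0 + (B : ℝ)} ∧ EqOn r.integrand (fun x => (a : ℝ) / Real.sqrt (x 0 ^ 3 + (A : ℝ) * x 0 + (B : ℝ))) r.domain ∧ d = KZ.of r},
      KZ.eval e = 0 → e ∈ AddSubgroup.closure gens := by
  intro e he he0
  refine realPeriodCellKernel hHW e (AddSubgroup.closure_mono ?_ he) he0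
  rintro d ⟨A, B, a, r, hΔ, -, hd, hi, rfl⟩
  exact ⟨A, B, a, r, hΔ, hd, hi, rfl⟩

/-! ### Stub K — the remainder `KernelModElliptic` (crux-sized: ↔ the summit given the cell) -/

/-- **K = `KernelModElliptic`** — every kernel element is an honest relation modulo an element of the elliptic
real-period sector. Given the cell it is EQUIVALENT to the crux, hence to the summit
(`stub_kernelModElliptic_iff_summit`); no line on this crux can close it short of the Kontsevich–Zagier period
conjecture. Carried openly. -/
theorem stub_kernelModElliptic : ∀ c : KZ.FormalRep, KZ.eval c = 0 → ∃ e ∈ AddSubgroup.closure {d : KZ.FormalRep | ∃ (A B : ℤ) (a : ℚ) (r : KZ.IntegralRep 1), 4 * A ^ 3 + 27 * B ^ 2 ≠ 0 ∧ 0 < a ∧ r.domain = {x | 0 < x 0 ^ 3 + (A : ℝ) * x 0 + (B : ℝ)} ∧ EqOn r.integrand (fun x => (a : ℝ) / Real.sqrt (x 0 ^ 3 + (A : ℝ) * x 0 + (B : ℝ))) r.domain ∧ d = KZ.of r}, c - e ∈ KZ.relations := by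
  sorry

/-- K follows from the crux UNCONDITIONALLY (sector element `0`; `closure gens = KZ.relations` by the proved
transfer). -/
theorem kernelModElliptic_of_xMapKernel (hX : XMapKernel) : ∀ c : KZ.FormalRep, KZ.eval c = 0 → ∃ e ∈ AddSubgroup.closure {d : KZ.FormalRep | ∃ (A B : ℤ) (a : ℚ) (r : KZ.IntegralRep 1), 4 * A ^ 3 + 27 * B ^ 2 ≠ 0 ∧ 0 < a ∧ r.domain = {x | 0 < x 0 ^ 3 + (A : ℝ) * x 0 + (B : ℝ)} ∧ EqOn r.integrand (fun x => (a : ℝ) / Real.sqrt (x 0 ^ 3 + (A : ℝ) * x 0 + (B : ℝ))) r.domain ∧ d = KZ.of r}, c - e ∈ KZ.relations := by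
  intro c hc
  refine ⟨0, AddSubgroup.zero_mem _, ?_⟩
  rw [sub_zero, ← closure_gens_eq_relations (xMapRel_subset_relations_iff_transfer.2
    XMapPeriodTransferCells.XMapPeriodTransfer_of)]
  exact (crux_iff.1 hX) c hc

/-! ### Composition -/

/-- **Composition** (`cardP_composition`): the cell (proved, under HW) + K ⇒ the crux `XMapKernel`, by name:
`c = (c − e) + e`, `c − e ∈ relations ≤ closure gens`, `eval e = 0` by soundness, `e ∈ closure gens` by the cell.
Open after registration 1: `stub_huberWustholzManyCurvePeriods` (fact), `stub_kernelModElliptic` (= summit). -/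
theorem XMapKernel_of : XMapKernel := by
  rw [crux_iff]
  intro c hc
  obtain ⟨e, he, hce⟩ := stub_kernelModElliptic c hc
  have hce' : c - e ∈ AddSubgroup.closure gens := relations_le_closure_gens hce
  have hdiff : KZ.eval (c - e) = 0 := AddMonoidHom.mem_ker.1 (closure_gens_le_ker_eval hce')
  have he0 : KZ.eval e = 0 := by
    rw [map_sub, hc, zero_sub, neg_eq_zero] at hdiff
    exact hdiff
  have : c = (c - e) + e := by abel
  rw [this]
  exact AddSubgroup.add_mem _ hce' (ellipticSectorKernel_of stub_huberWustholzManyCurvePeriods e he he0)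

/-- **Why K is crux-sized**: given HW (so that the cell holds), K ↔ `KontsevichZagierPeriods`. -/
theorem stub_kernelModElliptic_iff_summit (hHW : Literature.NumberTheory.Transcendental.HuberWustholzManyCurvePeriods) :
    (∀ c : KZ.FormalRep, KZ.eval c = 0 → ∃ e ∈ AddSubgroup.closure {d : KZ.FormalRep | ∃ (A B : ℤ) (a : ℚ) (r : KZ.IntegralRep 1), 4 * A ^ 3 + 27 * B ^ 2 ≠ 0 ∧ 0 < a ∧ r.domain = {x | 0 < x 0 ^ 3 + (A : ℝ) * x 0 + (B : ℝ)} ∧ EqOn r.integrand (fun x => (a : ℝ) / Real.sqrt (x 0 ^ 3 + (A : ℝ) * x 0 + (B : ℝ))) r.domain ∧ d = KZ.of r}, c - e ∈ KZ.relations) ↔ KontsevichZagierPeriods := by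
  refine Iff.trans ?_ (iff_summit_of_transfer XMapPeriodTransferCells.XMapPeriodTransfer_of)
  constructor
  · intro hK
    rw [crux_iff]
    intro c hc
    obtain ⟨e, he, hce⟩ := hK c hc
    have hce' : c - e ∈ AddSubgroup.closure gens := relations_le_closure_gens hce
    have hdiff : KZ.eval (c - e) = 0 := AddMonoidHom.mem_ker.1 (closure_gens_le_ker_eval hce')
    have he0 : KZ.eval e = 0 := by
      rw [map_sub, hc, zero_sub, neg_eq_zero] at hdiff
      exact hdiff
    have : c = (c - e) + e := by abel
    rw [this]
    exact AddSubgroup.add_mem _ hce' (ellipticSectorKernel_of hHW e he he0)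
  · exact kernelModElliptic_of_xMapKernel

end Summit.KontsevichZagierPeriods.KontsevichZagierPeriods.Cruxes.XMapKernel.Lines.AxiomSaturatedSectorPeeling

end
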